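import Mathlib.Analysis.Calculus.Deriv.MeanValue
import Mathlib.Analysis.Calculus.Deriv.Inv

/-!
# Route `AnisotropyChord`: the rook-graph overlap profile (real analysis for the two-magnon rung
# TM-VT on `K_m □ K_n`; bears on `FerroSideChord` stmt-19089 via `…SpinMonotoneDefs`)

Pure real analysis, no graph theory.  In the two-magnon sector of `H(Δ) = xxzHamiltonian 1 G (−1) Δ`
on the rook graph `G = K_{p+1} □ K_{q+1}` the sector ground states form an explicit one-parameter
family `t ≥ 0` (companion file `…TwoMagnonRook`): relative amplitudes `q/(q+t)`, `p/(p+t)`, `1` on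
row pairs, column pairs and non-adjacent pairs, anisotropy `σ = 1 − Δ = t·(1 + 1/(p+t) + 1/(q+t))`,
and squared flat overlap `(N/2)·p q·Nu(t)²/De(t)` with
`Nu(t) = (p+t)(q+t) + (p+t) + (q+t)`, `De(t) = (p+t)²(q+t)² + p(q+t)² + q(p+t)²`.
This file proves the two calculus facts the rung needs:
* `rookProfile_antitoneOn`: `t ↦ Nu(t)²/De(t)` is non-increasing on `[0, ∞)` — its derivative is
  `−t·Nu(t)·R(t)/De(t)²` with `R = 2(p−q)² + 2p³ + 2q³ + 6t(p²+q²) + 6t²(p+q) + 4t³ ≥ 0`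
  (mean value theorem, `antitoneOn_of_deriv_nonpos`);
* `rookSigma_lt`: `t ↦ t·(1 + 1/(p+t) + 1/(q+t))` is strictly increasing on `[0, ∞)`, so the
  anisotropy determines the parameter (`rook_le_of_sigma_le`), with no implicit-function argument;
* `rookOverlap_le`: the resulting two-point comparison `0 ≤ t₂ ≤ t₁ ⇒ F(t₁) ≤ F(t₂)`.
Theory seat `hubbard-h0-rotor-theory-1` (cycle 5, rook family) for context.  No definition is
introduced.
-/

set_option linter.dupNamespace false

namespace Summit.HubbardSuperconductivity.HubbardSuperconductivity.Theorems.AnisotropyChord.TwoMagnon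

/-- The rook-graph overlap profile `Nu²/De` is non-increasing on `[0, ∞)` (`p, q > 0`):
`d/dt (Nu²/De) = −t·Nu·(2(p−q)² + 2p³ + 2q³ + 6t(p²+q²) + 6t²(p+q) + 4t³)/De² ≤ 0`. [folklore] -/
theorem rookProfile_antitoneOn {p q : ℝ} (hp : 0 < p) (hq : 0 < q) :
    AntitoneOn (fun t : ℝ => ((p + t) * (q + t) + (p + t) + (q + t)) ^ 2 /
      ((p + t) ^ 2 * (q + t) ^ 2 + p * (q + t) ^ 2 + q * (p + t) ^ 2)) (Set.Ici 0) := by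
  set N : ℝ → ℝ := fun t => (p + t) * (q + t) + (p + t) + (q + t) with hN
  set D : ℝ → ℝ := fun t => (p + t) ^ 2 * (q + t) ^ 2 + p * (q + t) ^ 2 + q * (p + t) ^ 2 with hD
  have hDpos : ∀ t, 0 ≤ t → 0 < D t := by
    intro t ht
    simp only [hD]
    positivity
  have hNpos : ∀ t, 0 ≤ t → 0 < N t := by
    intro t ht
    simp only [hN]
    positivity
  -- derivatives of `N` and `D`
  have hNd : ∀ t, HasDerivAt N ((q + t) + (p + t) + 2) t := by
    intro t
    have h1 : HasDerivAt (fun t => p + t) 1 t := (hasDerivAt_id t).const_add p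
    have h2 : HasDerivAt (fun t => q + t) 1 t := (hasDerivAt_id t).const_add q
    have h : HasDerivAt (fun t => (p + t) * (q + t) + (p + t) + (q + t))
        (1 * (q + t) + (p + t) * 1 + 1 + 1) t := ((h1.fun_mul h2).fun_add h1).fun_add h2
    exact h.congr_deriv (by ring)
  have hDd : ∀ t, HasDerivAt D
      (2 * (p + t) * (q + t) ^ 2 + 2 * (p + t) ^ 2 * (q + t) + 2 * p * (q + t) + 2 * q * (p + t)) t := by
    intro t
    have h1 : HasDerivAt (fun t => p + t) 1 t := (hasDerivAt_id t).const_add p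
    have h2 : HasDerivAt (fun t => q + t) 1 t := (hasDerivAt_id t).const_add q
    have h11 : HasDerivAt (fun t => (p + t) ^ 2) (2 * (p + t)) t := by
      have h : HasDerivAt (fun t => (p + t) * (p + t)) (1 * (p + t) + (p + t) * 1) t := h1.fun_mul h1
      refine (h.congr_of_eventuallyEq (Filter.Eventually.of_forall fun x => ?_)).congr_deriv (by ring)
      simp only [pow_two]
    have h22 : HasDerivAt (fun t => (q + t) ^ 2) (2 * (q + t)) t := by
      have h : HasDerivAt (fun t => (q + t) * (q + t)) (1 * (q + t) + (q + t) * 1) t := h2.fun_mul h2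
      refine (h.congr_of_eventuallyEq (Filter.Eventually.of_forall fun x => ?_)).congr_deriv (by ring)
      simp only [pow_two]
    have h : HasDerivAt (fun t => (p + t) ^ 2 * (q + t) ^ 2 + p * (q + t) ^ 2 + q * (p + t) ^ 2)
        (2 * (p + t) * (q + t) ^ 2 + (p + t) ^ 2 * (2 * (q + t)) + p * (2 * (q + t))
          + q * (2 * (p + t))) t :=
      ((h11.fun_mul h22).fun_add (h22.const_mul p)).fun_add (h11.const_mul q)
    exact h.congr_deriv (by ring)
  -- the quotient
  have hFd : ∀ t, 0 ≤ t → HasDerivAt (fun t => N t ^ 2 / D t)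
      (((((q + t) + (p + t) + 2) * N t + N t * ((q + t) + (p + t) + 2)) * D t
        - N t ^ 2 * (2 * (p + t) * (q + t) ^ 2 + 2 * (p + t) ^ 2 * (q + t)
            + 2 * p * (q + t) + 2 * q * (p + t))) / D t ^ 2) t := by
    intro t ht
    have hN2 : HasDerivAt (fun t => N t ^ 2) (((q + t) + (p + t) + 2) * N t + N t * ((q + t) + (p + t) + 2)) t := by
      have h : HasDerivAt (fun t => N t * N t)
          (((q + t) + (p + t) + 2) * N t + N t * ((q + t) + (p + t) + 2)) t := (hNd t).fun_mul (hNd t)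
      refine HasDerivAt.congr_of_eventuallyEq h (Filter.Eventually.of_forall fun x => ?_)
      simp only [pow_two]
    exact hN2.fun_div (hDd t) (hDpos t ht).ne'
  refine antitoneOn_of_deriv_nonpos (convex_Ici 0) ?_ ?_ ?_
  · -- continuity on `[0, ∞)`
    have hc : ContinuousOn (fun t => N t ^ 2 / D t) (Set.Ici 0) := by
      intro t ht
      exact (hFd t ht).continuousAt.continuousWithinAt
    exact hc
  · -- differentiability on the interior
    intro t ht
    rw [interior_Ici] at ht
    exact (hFd t (le_of_lt ht)).differentiableAt.differentiableWithinAt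
  · -- sign of the derivative
    intro t ht
    rw [interior_Ici] at ht
    have ht0 : 0 ≤ t := le_of_lt ht
    rw [(hFd t ht0).deriv]
    apply div_nonpos_of_nonpos_of_nonneg _ (sq_nonneg _)
    -- numerator `= N·(2N′D − N D′) = −N·t·R`
    have key : (((q + t) + (p + t) + 2) * N t + N t * ((q + t) + (p + t) + 2)) * D t
        - N t ^ 2 * (2 * (p + t) * (q + t) ^ 2 + 2 * (p + t) ^ 2 * (q + t)
            + 2 * p * (q + t) + 2 * q * (p + t))
        = -(N t * (t * (2 * (p - q) ^ 2 + 2 * p ^ 3 + 2 * q ^ 3 + 6 * t * (p ^ 2 + q ^ 2)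
            + 6 * t ^ 2 * (p + q) + 4 * t ^ 3))) := by
      simp only [hN, hD]
      ring
    rw [key, neg_nonpos]
    have h1 := hNpos t ht0
    positivity

/-- The rook-graph anisotropy profile `t ↦ t·(1 + 1/(p+t) + 1/(q+t))` (`= σ = 1 − Δ` along the
ground-state family) is strictly increasing on `[0, ∞)` (`p, q > 0`). [folklore] -/
theorem rookSigma_lt {p q s t : ℝ} (hp : 0 < p) (hq : 0 < q) (hs : 0 ≤ s) (hst : s < t) :
    s * (1 + 1 / (p + s) + 1 / (q + s)) < t * (1 + 1 / (p + t) + 1 / (q + t)) := by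
  have ht : 0 ≤ t := le_trans hs hst.le
  have hps : 0 < p + s := by linarith
  have hpt : 0 < p + t := by linarith
  have hqs : 0 < q + s := by linarith
  have hqt : 0 < q + t := by linarith
  have e1 : s * (1 + 1 / (p + s) + 1 / (q + s)) = s + s / (p + s) + s / (q + s) := by ring
  have e2 : t * (1 + 1 / (p + t) + 1 / (q + t)) = t + t / (p + t) + t / (q + t) := by ring
  rw [e1, e2]
  have h1 : s / (p + s) ≤ t / (p + t) := by
    rw [div_le_div_iff₀ hps hpt]
    nlinarith
  have h2 : s / (q + s) ≤ t / (q + t) := by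
    rw [div_le_div_iff₀ hqs hqt]
    nlinarith
  linarith

/-- Contrapositive form used by the rook theorem: if `σ(t₂) ≤ σ(t₁)` with `t₁, t₂ ≥ 0` then
`t₂ ≤ t₁`. [folklore] -/
theorem rook_le_of_sigma_le {p q t₁ t₂ : ℝ} (hp : 0 < p) (hq : 0 < q) (h₁ : 0 ≤ t₁)
    (h : t₂ * (1 + 1 / (p + t₂) + 1 / (q + t₂)) ≤ t₁ * (1 + 1 / (p + t₁) + 1 / (q + t₁))) :
    t₂ ≤ t₁ := by
  by_contra hlt
  exact absurd h (not_le.mpr (rookSigma_lt hp hq h₁ (lt_of_not_ge hlt)))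

/-- **The overlap comparison along the rook ground-state family**: for `p, q > 0` and
`0 ≤ t₂ ≤ t₁`, `p q·Nu(t₁)²/De(t₁) ≤ p q·Nu(t₂)²/De(t₂)`. [folklore] -/
theorem rookOverlap_le {p q t₁ t₂ : ℝ} (hp : 0 < p) (hq : 0 < q) (h₂ : 0 ≤ t₂) (h21 : t₂ ≤ t₁) :
    p * q * (((p + t₁) * (q + t₁) + (p + t₁) + (q + t₁)) ^ 2 /
        ((p + t₁) ^ 2 * (q + t₁) ^ 2 + p * (q + t₁) ^ 2 + q * (p + t₁) ^ 2)) ≤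
      p * q * (((p + t₂) * (q + t₂) + (p + t₂) + (q + t₂)) ^ 2 /
        ((p + t₂) ^ 2 * (q + t₂) ^ 2 + p * (q + t₂) ^ 2 + q * (p + t₂) ^ 2)) := by
  have h := rookProfile_antitoneOn hp hq (Set.mem_Ici.2 h₂) (Set.mem_Ici.2 (le_trans h₂ h21)) h21
  exact mul_le_mul_of_nonneg_left h (mul_pos hp hq).le

end Summit.HubbardSuperconductivity.HubbardSuperconductivity.Theorems.AnisotropyChord.TwoMagnon
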